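import Literature.NumberTheory.Automorphic.TwistedHeckeTheoryGL2
import Literature.NumberTheory.Automorphic.ArchHeckeTestVectorGammaGL2
import HarnessLib

/-!
# Discharge of `JacquetLanglands1970_twistedHeckeTheoryGL2` (Jacquet–Langlands (1970), Thm. 11.1, Cor. 11.2)

Topic `Literature/NumberTheory/Automorphic`. Proofs only (no definition, no named fact, no instance).

The named fact `JacquetLanglands1970_twistedHeckeTheoryGL2` (`TwistedHeckeTheoryGL2.lean`: the
Galois-indexed twisted Hecke theory of a cuspidal automorphic representation of `GL₂(𝔸_F)` — Euler
product and functional equation of `L(s, π ⊗ (χ∘Art))` for every finite-order Galois character `χ`) is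
PROVED: the purely archimedean input `(A_GP)` (two Gamma products for one `K_∞`-finite Hecke test vector,
`ArchHeckeTestVectorGammaGL2.archKirillovGammaProduct`, Jacquet–Langlands' Thm. 5.15 / Thm. 6.4) feeds the
accepted reduction chain `(A_GP) ⇒ (A_Γ) ⇒ JacquetLanglands1970_standardLTheoryGL2 ⇒
JacquetLanglands1970_twistedHeckeTheoryGL2` (`HeckeEulerFactorisationGL2GammaProduct`,
`HeckeEulerFactorisationGL2ArchGamma`, `HeckeEulerFactorisationGL2DualKirillov`,
`TwistedHeckeTheoryGL2OfStandardLTheoryGL2Proofs`).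

## References

* H. Jacquet, R. P. Langlands, *Automorphic Forms on GL(2)*, LNM 114 (1970), Thm. 11.1, Cor. 11.2, §12;
  §5 Thm. 5.15, §6 Thm. 6.4. [JacquetLanglands1970]
-/

namespace Literature.NumberTheory.Automorphic

/-- **Jacquet–Langlands (1970), Thm. 11.1 / Cor. 11.2 with §12: the Galois-twisted Hecke theory of cuspidal
`GL₂` — the named fact `JacquetLanglands1970_twistedHeckeTheoryGL2` holds.**
[cite: JacquetLanglands1970, Thm. 11.1, Cor. 11.2, Thm. 5.15, Thm. 6.4] -/
theorem JacquetLanglands1970_twistedHeckeTheoryGL2_holds : JacquetLanglands1970_twistedHeckeTheoryGL2 :=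
  twistedHeckeTheoryGL2_and_frobSatakeCompatibleAt_of_archKirillovGammaProduct'.1

end Literature.NumberTheory.Automorphic
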